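import Summits.QuantumFields.YangMills.Theorems.ConvexGribovBodyBrascampLiebVacuumSCOnelinkHSPoincare
import Summits.QuantumFields.YangMills.Theorems.ConvexGribovBodyBrascampLiebVacuumSCOnelinkHSHeatBath

/-!
# Crux `BrascampLiebVacuumSC` (stmt-QuantumFields-16404), line `SketchIdeator1`: stub `stub_onelinkHS`

The annealed one-link metric-slope Poincaré inequality: for a compact simple `G` with faithful
unitary representation `r` and every `β` there is `κ₁ = κ₁(G, r, β) ≥ 0` such that on every torus
`(2S+1)⁴`, for every link `ℓ` and every link-Lipschitz `f`,
`∫ (E_ℓ(f²) − (E_ℓ f)²) dμ ≤ κ₁ ∫ slope_ℓ(f)² dμ` (`μ` Wilson's measure `wilson4 r β S`, `E_ℓ = hbOp` the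
one-link heat-bath operator, `slope_ℓ f U` the metric slope of `g ↦ f(U[ℓ ↦ g])` at `U ℓ` in the Frobenius
metric pulled back by `r.ρ`).

Proof (`κ₁ = e^{Ω} κ e^{Ω}`): per background `U`, the conditional variance is at most the mean-square
deviation of the link function `ψ_U = f(U[ℓ ↦ ·])` from its Haar mean under the heat-bath law
(`onelink_var_le`), which is `≤ e^{Ω} ×` the Haar mean-square deviation (`onelink_integral_hbLaw_le`),
which is `≤ κ ∫ slope(ψ_U)² dHaar` by the Haar Poincaré inequality of the compact connected Lie group `G`
(`onelink_haar_poincare`: von Neumann's closed-subgroup theorem for `r.ρ(G) ⊆ U(N)`, word decomposition,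
one-parameter estimate), which is `≤ e^{Ω} κ ∫ slope(ψ_U)² dν_ℓ^U` (`onelink_lintegral_haar_le`); along the
fibre `slope(ψ_U)(g) = slope_ℓ f (U[ℓ ↦ g])` (`onelink_cslope_facts`), so the bound is `κ₁ E_ℓ(slope_ℓ f²)(U)`,
and the DLR identity `∫ E_ℓ h dμ = ∫ h dμ` (`PoincareClustering.integral_hbOp_wilsonMeasure`, `h = slope²`
bounded by `K²` and measurable) anneals.

References: J. von Neumann, Math. Z. 30 (1929) 3–42; T. Bröcker, T. tom Dieck, *Representations of
Compact Lie Groups* (1985), I (3.11); R. Holley, D. Stroock, J. Stat. Phys. 46 (1987) 1159–1194;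
F. Martinelli, *Lectures on Glauber dynamics for discrete spin models*, LNM 1717 (1999), §2.3.
-/

open scoped BigOperators Topology Matrix ENNReal
open Filter MeasureTheory ProbabilityTheory
open Literature.MathematicalPhysics.QuantumFieldTheory
open Literature.RepresentationTheory.CompactGroups
open Summit.QuantumFields.YangMills.Cruxes.CovarianceBound.SupportWindow
  (froSq coulombF IsCoulMin gluon modeCov supCov wilson4)
open Summit.QuantumFields.YangMills.Theorems.PoincareClustering (hbLaw hbOp)

noncomputable section

namespace Summit.QuantumFields.YangMills.Theorems.BrascampLiebVacuumSC

/-! ### The stub -/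

/-- **Stub (ANALYSIS ON `G` — annealed one-link Holley–Stroock).** For compact simple `G`, faithful `r` and
every `β` there is `κ₁ = κ₁(G,r,β) ≥ 0` such that on every torus, for every link `ℓ` and every link-Lipschitz
`f`: `∫ (E_ℓ(f²) − (E_ℓ f)²) dμ ≤ κ₁ ∫ slope_ℓ(f)² dμ` — the `μ`-average of the one-link conditional
variance is bounded by the `μ`-average of the squared metric slope in that link (Haar Poincaré inequality of
the connected compact Lie group `G` in the `r.ρ`-Frobenius metric, Holley–Stroock for the tilt
`-β S_W(U[ℓ ↦ ·])` whose oscillation is volume-free, DLR to anneal). [folklore] -/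
theorem stub_onelinkHS :
    ∀ (G : Type) [Group G] [TopologicalSpace G] [IsTopologicalGroup G] [CompactSpace G]
    [MeasurableSpace G] [BorelSpace G], IsCompactSimpleLieGroup G →
    ∀ (r : LatticeRep G) (β : ℝ), ∃ κ₁ : ℝ, 0 ≤ κ₁ ∧ ∀ (S : ℕ) (ℓ : Edge 4 (2 * S + 1))
    (f : GaugeConfig 4 (2 * S + 1) G → ℝ),
      (∃ K : ℝ, ∀ U V : GaugeConfig 4 (2 * S + 1) G,
        |f U - f V| ≤ K * ∑ e, Real.sqrt (froSq (r.ρ (U e) - r.ρ (V e)))) →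
      ∫ U, (hbOp r.ρ β ℓ (fun V => f V ^ 2) U - (hbOp r.ρ β ℓ f U) ^ 2) ∂(wilson4 r β S) ≤
        κ₁ * ∫ U, (Filter.limsup (fun g : G => |f (Function.update U ℓ g) - f U| /
          Real.sqrt (froSq (r.ρ g - r.ρ (U ℓ)))) (𝓝[≠] (U ℓ))) ^ 2 ∂(wilson4 r β S) := by
  intro G _ _ _ _ _ _ hG r β
  -- structure on `G`: connected, non-trivial, second countable
  haveI : ConnectedSpace G := hG.1.1
  haveI : Nontrivial G := by
    obtain ⟨a, b, hab⟩ := hG.1.2.1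
    exact ⟨⟨a, b, fun h => hab (by rw [h])⟩⟩
  haveI : SecondCountableTopology G :=
    (r.continuous.isClosedEmbedding r.injective).isEmbedding.secondCountableTopology
  obtain ⟨κ, hκ0, hP⟩ := onelink_haar_poincare r
  obtain ⟨Ω, hΩ0, hΩ⟩ := onelink_osc r β
  refine ⟨Real.exp Ω * κ * Real.exp Ω, by positivity, fun S ℓ f hfK => ?_⟩
  obtain ⟨K₀, hK₀⟩ := hfK
  -- WLOG the Lipschitz constant is non-negative
  set K := max K₀ 0 with hKdef
  have hK : 0 ≤ K := le_max_right _ _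
  have hf : ∀ U V : GaugeConfig 4 (2 * S + 1) G,
      |f U - f V| ≤ K * ∑ e, Real.sqrt (froSq (r.ρ (U e) - r.ρ (V e))) := fun U V =>
    (hK₀ U V).trans (mul_le_mul_of_nonneg_right (le_max_left _ _)
      (Finset.sum_nonneg fun e _ => Real.sqrt_nonneg _))
  -- the slope field and its four properties
  obtain ⟨hsm, hs0, hsK, hsfib⟩ := onelink_cslope_facts r hK hf ℓ
  have hfc : Continuous f := onelink_continuous_cfg r hf
  have hfm : Measurable f := hfc.measurable
  obtain ⟨Mf, hMf⟩ : ∃ M : ℝ, ∀ U, |f U| ≤ M := by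
    obtain ⟨M, hM⟩ := isCompact_univ.exists_bound_of_continuousOn hfc.continuousOn
    exact ⟨M, fun U => by have := hM U (Set.mem_univ U); rwa [Real.norm_eq_abs] at this⟩
  set μ := wilson4 r β S with hμ
  set κ₁ := Real.exp Ω * κ * Real.exp Ω with hκ₁
  have hκ₁0 : 0 ≤ κ₁ := by positivity
  have hs2m : Measurable fun V : GaugeConfig 4 (2 * S + 1) G => (limsup (fun g => |f
      (Function.update V ℓ g) - f V| / Real.sqrt (froSq (r.ρ g - r.ρ (V ℓ)))) (𝓝[≠] (V ℓ))) ^ 2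
      := hsm.pow_const 2
  have hs2b : ∀ V : GaugeConfig 4 (2 * S + 1) G, |(limsup (fun g => |f (Function.update V ℓ g) -
      f V| / Real.sqrt (froSq (r.ρ g - r.ρ (V ℓ)))) (𝓝[≠] (V ℓ))) ^ 2| ≤ K ^ 2 := fun V => by
    rw [abs_of_nonneg (sq_nonneg _)]
    exact pow_le_pow_left₀ (hs0 V) (hsK V) 2
  -- the per-background bound
  have hU : ∀ U : GaugeConfig 4 (2 * S + 1) G,
      hbOp r.ρ β ℓ (fun V => f V ^ 2) U - (hbOp r.ρ β ℓ f U) ^ 2 ≤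
        κ₁ * hbOp r.ρ β ℓ (fun V => (limsup (fun g => |f (Function.update V ℓ g) - f V| /
            Real.sqrt (froSq (r.ρ g - r.ρ (V ℓ)))) (𝓝[≠] (V ℓ))) ^ 2) U := fun U => by
    have hlip : ∀ g h : G, |f (Function.update U ℓ g) - f (Function.update U ℓ h)| ≤
        K * frobNorm (r.ρ g - r.ρ h) := onelink_lip_link r hf ℓ U
    have hψc : Continuous fun g : G => f (Function.update U ℓ g) := onelink_continuous_of_lip r hlip
    -- (c) Haar Poincaré for the link function, (d) Haar ≤ e^Ω heat bath
    have hcP := hP (fun g : G => f (Function.update U ℓ g)) K hK hlip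
    have hdL := onelink_lintegral_haar_le r β ℓ U (hΩ S ℓ U) fun g : G =>
      limsup (fun h : G => ENNReal.ofReal (|f (Function.update U ℓ h) - f (Function.update U ℓ g)| /
        Real.sqrt (froSq (r.ρ h - r.ρ g)))) (𝓝[≠] g) ^ 2
    set ν := hbLaw r.ρ β ℓ U with hν
    haveI : IsProbabilityMeasure ν := PoincareClustering.isProbabilityMeasure_hbLaw r.ρ β
        r.continuous ℓ U
    set c : ℝ := ∫ g, f (Function.update U ℓ g) ∂haarProbability G with hc
    -- (a) variance ≤ mean square deviation from the Haar mean
    have ha : hbOp r.ρ β ℓ (fun V => f V ^ 2) U - (hbOp r.ρ β ℓ f U) ^ 2 ≤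
        ∫ g, (f (Function.update U ℓ g) - c) ^ 2 ∂ν :=
      onelink_var_le r β ℓ U hfm hMf c
    -- (b) heat bath ≤ e^Ω Haar
    have hdev_m : Measurable fun g : G => (f (Function.update U ℓ g) - c) ^ 2 :=
      ((hψc.sub continuous_const).pow 2).measurable
    obtain ⟨Bd, hBd⟩ : ∃ Bd : ℝ, ∀ g : G, |(f (Function.update U ℓ g) - c) ^ 2| ≤ Bd := by
      obtain ⟨B, hB⟩ := isCompact_univ.exists_bound_of_continuousOn
        ((hψc.sub continuous_const).pow 2).continuousOn
      exact ⟨B, fun g => by have := hB g (Set.mem_univ g); rwa [Real.norm_eq_abs] at this⟩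
    have hb : ∫ g, (f (Function.update U ℓ g) - c) ^ 2 ∂ν ≤
        Real.exp Ω * ∫ g, (f (Function.update U ℓ g) - c) ^ 2 ∂haarProbability G :=
      onelink_integral_hbLaw_le r β ℓ U (hΩ S ℓ U) hdev_m hBd fun g => sq_nonneg _
    -- (e) the fibre identity: the slope of the link function is the slope field along the fibre
    have hJi : Integrable (fun g : G => (limsup (fun g' => |f (Function.update (Function.update U
        ℓ g) ℓ g') - f (Function.update U ℓ g)| / Real.sqrt (froSq (r.ρ g' - r.ρ
        ((Function.update U ℓ g) ℓ)))) (𝓝[≠] ((Function.update U ℓ g) ℓ))) ^ 2) ν :=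
      integrable_of_measurable_of_abs_le (hs2m.comp (measurable_update U)) fun g => hs2b _
    have he : ∫⁻ g, limsup (fun h : G => ENNReal.ofReal (|f (Function.update U ℓ h) -
        f (Function.update U ℓ g)| / Real.sqrt (froSq (r.ρ h - r.ρ g)))) (𝓝[≠] g) ^ 2 ∂ν =
        ENNReal.ofReal (∫ g, (limsup (fun g' => |f (Function.update (Function.update U ℓ g) ℓ g')
            - f (Function.update U ℓ g)| / Real.sqrt (froSq (r.ρ g' - r.ρ ((Function.update U ℓ
            g) ℓ)))) (𝓝[≠] ((Function.update U ℓ g) ℓ))) ^ 2 ∂ν) := by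
      rw [ofReal_integral_eq_lintegral_ofReal hJi (ae_of_all _ fun g => sq_nonneg _)]
      refine lintegral_congr fun g => ?_
      rw [hsfib U g, ENNReal.ofReal_pow (hs0 _)]
    have hJ0 : 0 ≤ ∫ g, (limsup (fun g' => |f (Function.update (Function.update U ℓ g) ℓ g') - f
        (Function.update U ℓ g)| / Real.sqrt (froSq (r.ρ g' - r.ρ ((Function.update U ℓ g) ℓ))))
        (𝓝[≠] ((Function.update U ℓ g) ℓ))) ^ 2 ∂ν := integral_nonneg fun g => sq_nonneg _
    have hcde : ∫ g, (f (Function.update U ℓ g) - c) ^ 2 ∂haarProbability G ≤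
        κ * (Real.exp Ω * ∫ g, (limsup (fun g' => |f (Function.update (Function.update U ℓ g) ℓ
            g') - f (Function.update U ℓ g)| / Real.sqrt (froSq (r.ρ g' - r.ρ ((Function.update U
            ℓ g) ℓ)))) (𝓝[≠] ((Function.update U ℓ g) ℓ))) ^ 2 ∂ν) := by
      rw [← ENNReal.ofReal_le_ofReal_iff (by positivity)]
      calc ENNReal.ofReal (∫ g, (f (Function.update U ℓ g) - c) ^ 2 ∂haarProbability G)
          ≤ ENNReal.ofReal κ * ∫⁻ g, limsup (fun h : G => ENNReal.ofReal (|f (Function.update U ℓ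
              h) -
              f (Function.update U ℓ g)| / Real.sqrt (froSq (r.ρ h - r.ρ g)))) (𝓝[≠] g) ^ 2
                ∂haarProbability G := hcP
        _ ≤ ENNReal.ofReal κ * (ENNReal.ofReal (Real.exp Ω) * ∫⁻ g, limsup (fun h : G =>
              ENNReal.ofReal (|f (Function.update U ℓ h) - f (Function.update U ℓ g)| /
                Real.sqrt (froSq (r.ρ h - r.ρ g)))) (𝓝[≠] g) ^ 2 ∂ν) := by
            gcongr
        _ = ENNReal.ofReal (κ * (Real.exp Ω * ∫ g, (limsup (fun g' => |f (Function.update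
            (Function.update U ℓ g) ℓ g') - f (Function.update U ℓ g)| / Real.sqrt (froSq (r.ρ g'
            - r.ρ ((Function.update U ℓ g) ℓ)))) (𝓝[≠] ((Function.update U ℓ g) ℓ))) ^ 2 ∂ν)) := by
            rw [he, ← ENNReal.ofReal_mul (Real.exp_pos Ω).le, ← ENNReal.ofReal_mul hκ0]
    -- assemble
    have hJdef : hbOp r.ρ β ℓ (fun V => (limsup (fun g => |f (Function.update V ℓ g) - f V| /
        Real.sqrt (froSq (r.ρ g - r.ρ (V ℓ)))) (𝓝[≠] (V ℓ))) ^ 2) U =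
        ∫ g, (limsup (fun g' => |f (Function.update (Function.update U ℓ g) ℓ g') - f
            (Function.update U ℓ g)| / Real.sqrt (froSq (r.ρ g' - r.ρ ((Function.update U ℓ g)
            ℓ)))) (𝓝[≠] ((Function.update U ℓ g) ℓ))) ^ 2 ∂ν := rfl
    rw [hJdef]
    calc hbOp r.ρ β ℓ (fun V => f V ^ 2) U - (hbOp r.ρ β ℓ f U) ^ 2
        ≤ ∫ g, (f (Function.update U ℓ g) - c) ^ 2 ∂ν := ha
      _ ≤ Real.exp Ω * ∫ g, (f (Function.update U ℓ g) - c) ^ 2 ∂haarProbability G := hb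
      _ ≤ Real.exp Ω * (κ * (Real.exp Ω * ∫ g, (limsup (fun g' => |f (Function.update
          (Function.update U ℓ g) ℓ g') - f (Function.update U ℓ g)| / Real.sqrt (froSq (r.ρ g' -
          r.ρ ((Function.update U ℓ g) ℓ)))) (𝓝[≠] ((Function.update U ℓ g) ℓ))) ^ 2 ∂ν)) :=
          mul_le_mul_of_nonneg_left hcde (Real.exp_pos Ω).le
      _ = κ₁ * ∫ g, (limsup (fun g' => |f (Function.update (Function.update U ℓ g) ℓ g') - f
          (Function.update U ℓ g)| / Real.sqrt (froSq (r.ρ g' - r.ρ ((Function.update U ℓ g)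
          ℓ)))) (𝓝[≠] ((Function.update U ℓ g) ℓ))) ^ 2 ∂ν := by rw [hκ₁]; ring
  -- integrate over Wilson's measure and anneal by DLR
  have hLm : Measurable fun U => hbOp r.ρ β ℓ (fun V => f V ^ 2) U - (hbOp r.ρ β ℓ f U) ^ 2 :=
    (PoincareClustering.measurable_hbOp r.ρ β r.continuous ℓ (hfm.pow_const 2)).sub
      ((PoincareClustering.measurable_hbOp r.ρ β r.continuous ℓ hfm).pow_const 2)
  have hf2b : ∀ V, |f V ^ 2| ≤ Mf ^ 2 := fun V => by
    rw [abs_pow]; exact pow_le_pow_left₀ (abs_nonneg _) (hMf V) 2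
  have hLb : ∀ U, |hbOp r.ρ β ℓ (fun V => f V ^ 2) U - (hbOp r.ρ β ℓ f U) ^ 2| ≤ Mf ^ 2 + Mf ^ 2 :=
    fun U => by
      refine (abs_sub _ _).trans (add_le_add ?_ ?_)
      · exact PoincareClustering.abs_hbOp_le r.ρ β r.continuous ℓ hf2b U
      · rw [abs_pow]
        exact pow_le_pow_left₀ (abs_nonneg _) (PoincareClustering.abs_hbOp_le r.ρ β r.continuous
            ℓ hMf U) 2
  have hLi : Integrable (fun U => hbOp r.ρ β ℓ (fun V => f V ^ 2) U - (hbOp r.ρ β ℓ f U) ^ 2) μ :=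
    integrable_of_measurable_of_abs_le hLm hLb
  have hRm : Measurable (hbOp r.ρ β ℓ (fun V => (limsup (fun g => |f (Function.update V ℓ g) - f
      V| / Real.sqrt (froSq (r.ρ g - r.ρ (V ℓ)))) (𝓝[≠] (V ℓ))) ^ 2)) :=
    PoincareClustering.measurable_hbOp r.ρ β r.continuous ℓ hs2m
  have hRb : ∀ U, |hbOp r.ρ β ℓ (fun V => (limsup (fun g => |f (Function.update V ℓ g) - f V| /
      Real.sqrt (froSq (r.ρ g - r.ρ (V ℓ)))) (𝓝[≠] (V ℓ))) ^ 2) U| ≤ K ^ 2 :=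
    PoincareClustering.abs_hbOp_le r.ρ β r.continuous ℓ hs2b
  have hRi : Integrable (hbOp r.ρ β ℓ (fun V => (limsup (fun g => |f (Function.update V ℓ g) - f
      V| / Real.sqrt (froSq (r.ρ g - r.ρ (V ℓ)))) (𝓝[≠] (V ℓ))) ^ 2)) μ :=
    integrable_of_measurable_of_abs_le hRm hRb
  calc ∫ U, (hbOp r.ρ β ℓ (fun V => f V ^ 2) U - (hbOp r.ρ β ℓ f U) ^ 2) ∂μ
      ≤ ∫ U, κ₁ * hbOp r.ρ β ℓ (fun V => (limsup (fun g => |f (Function.update V ℓ g) - f V| /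
          Real.sqrt (froSq (r.ρ g - r.ρ (V ℓ)))) (𝓝[≠] (V ℓ))) ^ 2) U ∂μ := integral_mono hLi
          (hRi.const_mul _) hU
    _ = κ₁ * ∫ U, hbOp r.ρ β ℓ (fun V => (limsup (fun g => |f (Function.update V ℓ g) - f V| /
        Real.sqrt (froSq (r.ρ g - r.ρ (V ℓ)))) (𝓝[≠] (V ℓ))) ^ 2) U ∂μ := integral_const_mul _ _
    _ = κ₁ * ∫ U, (limsup (fun g => |f (Function.update U ℓ g) - f U| / Real.sqrt (froSq (r.ρ g -
        r.ρ (U ℓ)))) (𝓝[≠] (U ℓ))) ^ 2 ∂μ := by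
        rw [hμ]
        exact congrArg (κ₁ * ·)
          (PoincareClustering.integral_hbOp_wilsonMeasure r.ρ β r.continuous ℓ hs2m hs2b)

end Summit.QuantumFields.YangMills.Theorems.BrascampLiebVacuumSC

end
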